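import Literature.MathematicalPhysics.QuantumFieldTheory.Balaban1983to89.T4FinestToWindow

/-!
# T⁴ programme, node U5b/U5.E — THE AGE-0 (FINAL-LEVEL) DECOMPOSITION LAYER of the η-design: its term representation,
# its neutrality, and its sibling suppression `S ≡ 2` by the POLARITY-FLIP INVOLUTION (owed item (o1)-LEAN, first cut,
# of record `t4/T4-EST-U5bE2.md` §21.6; cell `pub-balaban`, estimate row T4-U5b.E2, lineage pv07, journal self-row
# T4-U5b.E2-ETA-O1-LEAN1°; version tag v1 (2026-08-19); LOW LEAF: imports `T4FinestToWindow` v1 only; ADDITIVE — no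
# existing module is modified)

HONEST FRAMING.  This module is KERNEL BOOKKEEPING (finite sums, a reindexing by an involution, Bochner-integral linearity)
for the cell's η-design.  It proves NO estimate of [Balaban1988RG2] / [Balaban1989LargeFieldI] / [Balaban1989LargeFieldII],
quotes NO sentence of Bałaban's series, carries NO cite tag and asserts nothing printed: every declaration is a statement about
the tree's own typed objects (`T4LipschitzLedger.TermRepr`/`sibW`/`Pol`/`facAt`, `T4LipschitzCutoff.SiblingSuppression`/`sibling`,
`T4WeightBudget.RelWeightBound`, `T4FinestToWindow.oldTr`/`oldDensity`/`cauchy_of_finest`, `Setup.fieldMeasure`,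
`T4Continuum.T4Family`) and is tagged [folklore].  NOT summit progress; rung (B)+1 bookkeeping on one four-torus; NOT infinite
volume, NOT a mass gap, NOT the Clay problem.

## What the layer is (cell bookkeeping; the SHAPE of a last decomposition of unity, not a printed statement)

A run of the η-design with cutoff `K_X` (`K` for run A, `K + 1` for run B) ends, at its LAST renormalization step, with a
decomposition of unity over the `nc K` cubes of the UNIT lattice (the window of depth `N_W = 0`): cube `i` carries either the
small-field PROFILE factor `χ₀(v_i/θ_i)` or its complement `1 − χ₀(v_i/θ_i)` (`T4LipschitzLedger.Pol`), the tested variable `v_i`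
being a measurable functional of the unit-lattice field, i.e. of the run's field through the old transport `oldTr F EML K_X 0`
(`T4FinestToWindow` §2).  A term of the layered family is a pair `(τ', S)`: an OLDER-HISTORY label `τ' ∈ T₀ K` (whatever the
supplier's family is — this module is agnostic about it) and the set `S ⊆ range (nc K)` of cubes carrying the LARGE polarity; ALL
`2^{nc K}` patterns are terms.  THE ONE STRUCTURAL FACT the module turns into kernel theorems: the `nc K` cube factors are functions
of the window field, so the finest-level REMAINDER of the term `(τ', S)` is the older history's accumulated weight `R_X K t τ'` —
THE SAME FOR EVERY PATTERN `S` (`layerRem`).  Consequences, all proved here with no hypothesis beyond the data's measurability /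
integrability / nonnegativity:

* §3 `termRepr_layer_A/_B`: the layered family INHABITS the binders `hA`/`hB` of `T4FinestToWindow.cauchy_of_finest` (window depth
  `fun _ ↦ 0`, slots `⟨0, i⟩`, polarity read off `S`, term weights DEFINED as the representing integrals `layerX`);
* §3 `sum_patterns_layerX` / `sum_layerT_layerX` (NEUTRALITY): summing the `2^{nc K}` patterns over an older history returns the
  older history's total weight `∫ R_X K t τ' dU` (the decomposition of unity under the integral, §1 `sum_powerset_prod_patFac`) —
  inserting the layer changes no partition function (`hZA`/`hZB` of `cauchy_of_finest` transfer from the older family), and the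
  bad-class relative weight bound `RelWeightBound` transfers unchanged (`relWeightBound_layer`);
* §2 `siblingSuppression_two_of_flip` (GENERIC, at the `TermRepr` level, any run, any space family constant in the term) and §3
  `siblingSuppression_layer`: `T4LipschitzCutoff.SiblingSuppression … (fun _ ↦ 2)` HOLDS for the layer's slots — the one-level
  instance of mechanism (A) of `T4SiblingInsertion` §0 (conservation at a decomposition of unity): the involution `S ↦ S ∆ {i}`
  flips the polarity at cube `i`, preserves everything else INCLUDING THE REMAINDER, and `sibling_i = ∏ fac(S) + ∏ fac(S ∆ {i})`
  pointwise (§1 `sibling_eq_prod_add_prod`), whence `Σ_τ sibW_{⟨0,i⟩}(τ) ≤ Σ_τ X(τ) + Σ_τ X(flip τ) = 2 · Σ_τ X(τ)`;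
* §4 `cauchy_of_finest_layer`: `cauchy_of_finest` with `hA`, `hB`, `hSA`, `hSB`, `hS`, `hT`, `hZA`, `hZB`, `hpos`, `hW` DISCHARGED onto
  older-history-level data; what REMAINS as binders is exactly: the two-run closeness of the cube functionals on the unit lattice
  (`hvc`, node U1a's rate `ρ`), node U5b's two-sided factor ledger `hsw` between the PATTERN-FREE old densities
  `oldDensity F EML K 0 (R_A K t τ')` and `oldDensity F EML (K + 1) 0 (R_B K t τ')` on the good older histories, the bad-class bound of
  the older family, and the numerical condition `W K + n₀ · (L₀ · 2 · ρ K) < 1`.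

What this first cut does NOT cover (record §21, owed): declared slots of ages `≥ 1` (alive young regions, window depth `N_W ≥ 1`,
species s3/s4 pending the referee's ruling Q-η-4), the block-axial species s2, the band cap `N₀` versus the printed `N(g_k)`.  The
typing decision T-1 of record §21 (remainder := conditional expectation of the raw weight given the window field) is INVISIBLE at
depth `0`: every downstream binder reads the remainder only through `oldDensity`, i.e. through the push-forward to the window, and the
raw older-history weight serves verbatim (`layerRem`).
-/

open MeasureTheory Finset
open scoped NNReal ENNReal symmDiff

namespace Literature.MathematicalPhysics.QuantumFieldTheory.Balaban1983to89.T4AgeZeroLayer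

open T4Continuum T4LevelShift T4AveragingDisintegration T4WindowLevelShift T4LipschitzLedger T4FiniteEpsInhabited
  BlockAveraging ExpMeanLog T4FinestToWindow
open T4IndicatorShell T4LipschitzCutoff T4WeightBudget T4HybridMatching T4CauchySum

/-! ## §1 Polarity flips and polarity patterns (pure finite algebra) -/

section Patterns

/-- THE FLIPPED POLARITY: small ↔ large. [folklore] -/
def polFlip : Pol → Pol
  | .small => .large
  | .large => .small

/-- unfolding. [folklore] -/
@[simp] theorem polFlip_small : polFlip Pol.small = Pol.large := rfl

/-- unfolding. [folklore] -/
@[simp] theorem polFlip_large : polFlip Pol.large = Pol.small := rfl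

/-- flipping twice is the identity. [folklore] -/
@[simp] theorem polFlip_polFlip (p : Pol) : polFlip (polFlip p) = p := by
  cases p <;> rfl

/-- **THE DECOMPOSITION OF UNITY AT ONE FACTOR**: the flipped polarity's factor is the complement `1 − x` of the factor. [folklore] -/
theorem fac_polFlip (p : Pol) (x : ℝ) : (polFlip p).fac x = 1 - p.fac x := by
  cases p <;> simp [polFlip]

/-- THE POLARITY PATTERN of a set `S` of cube indices: LARGE on `S`, SMALL off `S`. [folklore] -/
def patPol (S : Finset ℕ) (i : ℕ) : Pol := if i ∈ S then Pol.large else Pol.small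

/-- on the set the pattern is large … [folklore] -/
theorem patPol_of_mem {S : Finset ℕ} {i : ℕ} (h : i ∈ S) : patPol S i = Pol.large := if_pos h

/-- … off the set it is small. [folklore] -/
theorem patPol_of_not_mem {S : Finset ℕ} {i : ℕ} (h : i ∉ S) : patPol S i = Pol.small := if_neg h

/-- **FLIPPING ONE CUBE**: the pattern of `S ∆ {i}` is the pattern of `S` flipped AT `i` … [folklore] -/
theorem patPol_symmDiff_self (S : Finset ℕ) (i : ℕ) : patPol (S ∆ {i}) i = polFlip (patPol S i) := by
  by_cases h : i ∈ S
  · rw [patPol_of_mem h, polFlip_large, patPol_of_not_mem]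
    simp [Finset.mem_symmDiff, h]
  · rw [patPol_of_not_mem h, polFlip_small, patPol_of_mem]
    simp [Finset.mem_symmDiff, h]

/-- … and unchanged elsewhere. [folklore] -/
theorem patPol_symmDiff_ne (S : Finset ℕ) {i j : ℕ} (h : j ≠ i) : patPol (S ∆ {i}) j = patPol S j := by
  by_cases hj : j ∈ S
  · rw [patPol_of_mem hj, patPol_of_mem]
    simp [Finset.mem_symmDiff, hj, h]
  · rw [patPol_of_not_mem hj, patPol_of_not_mem]
    simp [Finset.mem_symmDiff, hj, h]

/-- flipping the same cube twice returns the pattern set. [folklore] -/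
theorem symmDiff_singleton_symmDiff_singleton (S : Finset ℕ) (i : ℕ) : S ∆ {i} ∆ {i} = S :=
  symmDiff_symmDiff_cancel_right _ _

/-- flipping a cube of the range keeps the pattern set inside the range. [folklore] -/
theorem symmDiff_singleton_subset_range {S : Finset ℕ} {nc i : ℕ} (hS : S ⊆ range nc) (hi : i < nc) :
    S ∆ {i} ⊆ range nc :=
  (symmDiff_le_sup (a := S) (b := {i})).trans (sup_le hS (Finset.singleton_subset_iff.2 (mem_range.2 hi)))

/-- **THE SIBLING IS THE TERM PLUS ITS FLIPPED TWIN (pointwise)**: for a factor family `p` and the family `q` that agrees with `p`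
except at position `i < n` where `q i = 1 − p i`, the slot-`i` sibling `∏_{j ≠ i} p_j` (`T4LipschitzCutoff.sibling`) equals
`∏_j p_j + ∏_j q_j`. [folklore] -/
theorem sibling_eq_prod_add_prod {p q : ℕ → ℝ} {n i : ℕ} (hi : i < n) (hq : ∀ j < n, j ≠ i → q j = p j)
    (hqi : q i = 1 - p i) : sibling p n i = ∏ j ∈ range n, p j + ∏ j ∈ range n, q j := by
  have split : ∀ r : ℕ → ℝ, ∏ j ∈ range n, r j = (∏ j ∈ range i, r j) * (r i * ∏ j ∈ Ico (i + 1) n, r j) := fun r => by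
    rw [← prod_range_mul_prod_Ico r hi.le, prod_eq_prod_Ico_succ_bot hi]
  have h1 : ∏ j ∈ range i, q j = ∏ j ∈ range i, p j :=
    prod_congr rfl fun j hj => hq j ((mem_range.1 hj).trans hi) (mem_range.1 hj).ne
  have h2 : ∏ j ∈ Ico (i + 1) n, q j = ∏ j ∈ Ico (i + 1) n, p j :=
    prod_congr rfl fun j hj => hq j (mem_Ico.1 hj).2 (by have := (mem_Ico.1 hj).1; omega)
  rw [split p, split q, h1, h2, hqi]
  unfold sibling
  ring

/-- **THE DECOMPOSITION OF UNITY OVER ALL PATTERNS**: `Σ_{S ⊆ s} ∏_{i ∈ s} fac_{S}(i) = ∏_{i ∈ s} (x_i + (1 − x_i)) = 1`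
(`Finset.prod_add`). [folklore] -/
theorem sum_powerset_prod_patFac (s : Finset ℕ) (x : ℕ → ℝ) :
    ∑ S ∈ s.powerset, ∏ i ∈ s, (patPol S i).fac (x i) = 1 := by
  have h1 : ∀ S ∈ s.powerset, ∏ i ∈ s, (patPol S i).fac (x i) = (∏ i ∈ S, (1 - x i)) * ∏ i ∈ s \ S, x i := by
    intro S hS
    have hSs : S ⊆ s := mem_powerset.1 hS
    rw [← prod_sdiff hSs, mul_comm]
    congr 1
    · exact prod_congr rfl fun i hi => by rw [patPol_of_mem hi, Pol.fac_large]
    · exact prod_congr rfl fun i hi => by rw [patPol_of_not_mem (mem_sdiff.1 hi).2, Pol.fac_small]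
  calc ∑ S ∈ s.powerset, ∏ i ∈ s, (patPol S i).fac (x i)
      = ∑ S ∈ s.powerset, (∏ i ∈ S, (1 - x i)) * ∏ i ∈ s \ S, x i := sum_congr rfl h1
    _ = ∏ i ∈ s, ((1 - x i) + x i) := (prod_add _ _ _).symm
    _ = 1 := prod_eq_one fun i _ => by ring

end Patterns

/-! ## §2 Generic: a flip-closed term family with flip-invariant remainders has sibling suppression `S ≡ 2` -/

section Flip

variable {ι : Type*} {Ω' : ℕ → Type*} [∀ K, MeasurableSpace (Ω' K)]

/-- **FLIP-CLOSURE DATA** of a run's term bookkeeping (cell bookkeeping, NOT a printed statement): for every cutoff `K` and slot `σ`,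
a map `φ K σ` of the index type which, on the run's terms `T K`, (i) stays in `T K`, (ii) is an involution, (iii) preserves the
number of factors, their slots, thresholds and tested variables, (iv) preserves the polarity of every factor NOT in slot `σ` and
FLIPS the polarity of the factor in slot `σ`; and (v) no term has two factors in the same slot.  (The space family is constant in the
term, `Ω K τ = Ω' K`, so that (iii) is an equality of functions.) [folklore] -/
structure FlipClosed (T : ℕ → Finset ι) (m : ℕ → ι → ℕ) (slot : ℕ → ι → ℕ → Σ _ : ℕ, ℕ) (pol : ℕ → ι → ℕ → Pol)
    (θ : ℕ → ι → ℕ → ℝ) (uX : (K : ℕ) → ι → ℕ → Ω' K → ℝ) (φ : ℕ → (Σ _ : ℕ, ℕ) → ι → ι) : Prop where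
  /-- flips of terms are terms -/
  mem : ∀ K σ, ∀ τ ∈ T K, φ K σ τ ∈ T K
  /-- flipping twice is the identity on terms -/
  invol : ∀ K σ, ∀ τ ∈ T K, φ K σ (φ K σ τ) = τ
  /-- the number of factors is preserved -/
  m_eq : ∀ K σ, ∀ τ ∈ T K, m K (φ K σ τ) = m K τ
  /-- slots are preserved -/
  slot_eq : ∀ K σ, ∀ τ ∈ T K, ∀ j < m K τ, slot K (φ K σ τ) j = slot K τ j
  /-- thresholds are preserved -/
  thr_eq : ∀ K σ, ∀ τ ∈ T K, ∀ j < m K τ, θ K (φ K σ τ) j = θ K τ j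
  /-- tested variables are preserved -/
  var_eq : ∀ K σ, ∀ τ ∈ T K, ∀ j < m K τ, uX K (φ K σ τ) j = uX K τ j
  /-- polarities off the slot are preserved … -/
  pol_eq : ∀ K σ, ∀ τ ∈ T K, ∀ j < m K τ, slot K τ j ≠ σ → pol K (φ K σ τ) j = pol K τ j
  /-- … and the polarity in the slot is flipped -/
  pol_flip : ∀ K σ, ∀ τ ∈ T K, ∀ j < m K τ, slot K τ j = σ → pol K (φ K σ τ) j = polFlip (pol K τ j)
  /-- one factor per slot -/
  inj : ∀ K, ∀ τ ∈ T K, ∀ j < m K τ, ∀ j' < m K τ, slot K τ j = slot K τ j' → j = j'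

variable {l₀ : ℝ} {T : ℕ → Finset ι} {X : ℕ → ℝ → ι → ℝ} {χ : ℕ → ℝ → ℝ} {κ Lχ : ℕ → ℝ} {N : ℕ} {n : ℕ → ℕ}
  {μ : (K : ℕ) → Measure (Ω' K)} {m : ℕ → ι → ℕ} {slot : ℕ → ι → ℕ → Σ _ : ℕ, ℕ} {pol : ℕ → ι → ℕ → Pol}
  {θ : ℕ → ι → ℕ → ℝ} {uX uY : (K : ℕ) → ι → ℕ → Ω' K → ℝ} {RX : (K : ℕ) → ℝ → ι → Ω' K → ℝ} {ρ : ℕ → ℝ}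
  {φ : ℕ → (Σ _ : ℕ, ℕ) → ι → ι}

/-- term weights of a represented run are nonnegative (`pieceW_nonneg` and `pieceW_le` of the ledger). [folklore] -/
theorem termRepr_nonneg {Ω : ℕ → ι → Type*} [∀ K τ, MeasurableSpace (Ω K τ)] {ν : (K : ℕ) → (τ : ι) → Measure (Ω K τ)}
    {vX vY : (K : ℕ) → (τ : ι) → ℕ → Ω K τ → ℝ} {R : (K : ℕ) → ℝ → (τ : ι) → Ω K τ → ℝ}
    (h : TermRepr l₀ T X χ κ Lχ N n ν m slot pol θ vX vY R) (K : ℕ) (t : ℝ) (ht : |t| ≤ l₀) (τ : ι) (hτ : τ ∈ T K) :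
    0 ≤ X K t τ :=
  (h.pieceW_nonneg ⟨0, 0⟩ K t ht τ hτ).trans (h.pieceW_le ⟨0, 0⟩ K t ht τ hτ)

/-- **PER TERM: the slot-`σ` sibling weight of `τ` is at most the weight of `τ` plus the weight of its `σ`-flip**, when the remainder
of the flipped term equals the remainder of the term almost everywhere.  (If `τ` has a factor in slot `σ` — exactly one, by (v) —:
`sibAt ≤ sibling` pointwise (the shell indicator is `≤ 1`), `sibling = ∏ fac(τ) + ∏ fac(φ τ)` pointwise by §1, integrate against the
common remainder and read the two representations; if it has none the sibling weight is `0`.) [folklore] -/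
theorem sibW_le_add_flip (h : TermRepr l₀ T X χ κ Lχ N n (fun K _ => μ K) m slot pol θ uX uY RX)
    (hφ : FlipClosed T m slot pol θ uX φ) {K : ℕ} {σ : Σ _ : ℕ, ℕ} {t : ℝ} (ht : |t| ≤ l₀)
    (hR : ∀ τ ∈ T K, RX K t (φ K σ τ) =ᵐ[μ K] RX K t τ) {τ : ι} (hτ : τ ∈ T K) :
    sibW χ κ (fun K _ => μ K) m slot pol θ uX RX ρ σ K t τ ≤ X K t τ + X K t (φ K σ τ) := by
  have hφτ : φ K σ τ ∈ T K := hφ.mem K σ τ hτ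
  by_cases hex : ∃ i < m K τ, slot K τ i = σ
  · obtain ⟨i, hi, hiσ⟩ := hex
    have hfilter : (range (m K τ)).filter (fun j => slot K τ j = σ) = {i} := by
      refine eq_singleton_iff_unique_mem.2 ⟨mem_filter.2 ⟨mem_range.2 hi, hiσ⟩, fun j hj => ?_⟩
      obtain ⟨hj, hjσ⟩ := mem_filter.1 hj
      exact hφ.inj K τ hτ j (mem_range.1 hj) i hi (hjσ.trans hiσ.symm)
    unfold sibW
    rw [hfilter, sum_singleton]
    have hsib : ∀ v, sibling (facAt χ (slot K τ) (pol K τ) (θ K τ) (fun j => uX K τ j v)) (m K τ) i =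
        (∏ j ∈ range (m K τ), facAt χ (slot K τ) (pol K τ) (θ K τ) (fun j => uX K τ j v) j) +
          ∏ j ∈ range (m K (φ K σ τ)), facAt χ (slot K (φ K σ τ)) (pol K (φ K σ τ)) (θ K (φ K σ τ))
            (fun j => uX K (φ K σ τ) j v) j := by
      intro v
      rw [hφ.m_eq K σ τ hτ]
      refine sibling_eq_prod_add_prod hi (fun j hj hji => ?_) ?_
      · have hne : slot K τ j ≠ σ := fun hh => hji (hφ.inj K τ hτ j hj i hi (hh.trans hiσ.symm))
        simp only [facAt, hφ.slot_eq K σ τ hτ j hj, hφ.thr_eq K σ τ hτ j hj, hφ.var_eq K σ τ hτ j hj,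
          hφ.pol_eq K σ τ hτ j hj hne]
      · simp only [facAt, hφ.slot_eq K σ τ hτ i hi, hφ.thr_eq K σ τ hτ i hi, hφ.var_eq K σ τ hτ i hi,
          hφ.pol_flip K σ τ hτ i hi hiσ, fac_polFlip]
    have h0 : 0 ≤ᵐ[μ K] RX K t τ := h.rem_nonneg K t ht τ hτ
    have hIs : Integrable (fun v => sibAt χ κ (slot K τ) (pol K τ) (θ K τ) (fun j => uX K τ j v)
        (ρ (K - (slot K τ i).1)) (m K τ) i * RX K t τ v) (μ K) := h.integrable_sib ht hτ hi _
    have hIτ : Integrable (fun v => (∏ j ∈ range (m K τ), facAt χ (slot K τ) (pol K τ) (θ K τ) (fun j => uX K τ j v) j) *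
        RX K t τ v) (μ K) := h.integrable_prod ht hτ
    have hIφ : Integrable (fun v => (∏ j ∈ range (m K (φ K σ τ)), facAt χ (slot K (φ K σ τ)) (pol K (φ K σ τ))
        (θ K (φ K σ τ)) (fun j => uX K (φ K σ τ) j v) j) * RX K t (φ K σ τ) v) (μ K) := h.integrable_prod ht hφτ
    calc ∫ v, sibAt χ κ (slot K τ) (pol K τ) (θ K τ) (fun j => uX K τ j v) (ρ (K - (slot K τ i).1)) (m K τ) i *
            RX K t τ v ∂μ K
        ≤ ∫ v, ((∏ j ∈ range (m K τ), facAt χ (slot K τ) (pol K τ) (θ K τ) (fun j => uX K τ j v) j) * RX K t τ v +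
            (∏ j ∈ range (m K (φ K σ τ)), facAt χ (slot K (φ K σ τ)) (pol K (φ K σ τ)) (θ K (φ K σ τ))
              (fun j => uX K (φ K σ τ) j v) j) * RX K t (φ K σ τ) v) ∂μ K := by
          refine integral_mono_ae hIs (hIτ.add hIφ) ?_
          filter_upwards [h0, hR τ hτ] with v hv hRv
          rw [hRv, ← add_mul, ← hsib v]
          unfold sibAt
          exact mul_le_mul_of_nonneg_right
            (mul_le_of_le_one_left (sibling_nonneg (fun j _ => facAt_nonneg h.profile j) hi) (Pol.shell_le_one _ _ _ _ _)) hv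
      _ = X K t τ + X K t (φ K σ τ) := by
          rw [integral_add hIτ hIφ, h.repr K t ht τ hτ, h.repr K t ht _ hφτ]
  · have hfilter : (range (m K τ)).filter (fun j => slot K τ j = σ) = ∅ :=
      filter_eq_empty_iff.2 fun j hj hjσ => hex ⟨j, mem_range.1 hj, hjσ⟩
    unfold sibW
    rw [hfilter, sum_empty]
    exact add_nonneg (termRepr_nonneg h K t ht τ hτ) (termRepr_nonneg h K t ht _ hφτ)

/-- **FLIP-CLOSURE ⇒ SIBLING SUPPRESSION `S ≡ 2`** (the one-level instance of mechanism (A) of `T4SiblingInsertion` §0 — conservation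
at a decomposition of unity —, at the `TermRepr` level, for ANY represented run on a space family constant in the term): if the run's
bookkeeping is flip-closed and the remainder of every flipped term equals the term's remainder almost everywhere, then for every slot
`σ` of the window, every `K` and every `|t| ≤ l₀`: `Σ_{τ ∈ T K} sibW_σ(τ) ≤ 2 · Σ_{τ ∈ T K} X K t τ` (per term `sibW_le_add_flip`, then
the flip is a bijection of `T K`: `Finset.sum_nbij'`).  NO estimate: positivity and reindexing only. [folklore] -/
theorem siblingSuppression_two_of_flip (h : TermRepr l₀ T X χ κ Lχ N n (fun K _ => μ K) m slot pol θ uX uY RX)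
    (hφ : FlipClosed T m slot pol θ uX φ) (hR : ∀ K σ t, |t| ≤ l₀ → ∀ τ ∈ T K, RX K t (φ K σ τ) =ᵐ[μ K] RX K t τ) :
    SiblingSuppression l₀ T X N n (sibW χ κ (fun K _ => μ K) m slot pol θ uX RX ρ) (fun _ => 2) := by
  intro σ _ K t ht
  show _ ≤ 2 * ∑ τ ∈ T K, X K t τ
  have hre : ∑ τ ∈ T K, X K t (φ K σ τ) = ∑ τ ∈ T K, X K t τ :=
    sum_nbij' (φ K σ) (φ K σ) (hφ.mem K σ) (hφ.mem K σ) (hφ.invol K σ) (hφ.invol K σ) fun _ _ => rfl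
  calc ∑ τ ∈ T K, sibW χ κ (fun K _ => μ K) m slot pol θ uX RX ρ σ K t τ
      ≤ ∑ τ ∈ T K, (X K t τ + X K t (φ K σ τ)) := sum_le_sum fun τ hτ => sibW_le_add_flip h hφ ht (hR K σ t ht) hτ
    _ = ∑ τ ∈ T K, X K t τ + ∑ τ ∈ T K, X K t (φ K σ τ) := sum_add_distrib
    _ = 2 * ∑ τ ∈ T K, X K t τ := by rw [hre]; ring

end Flip

/-! ## §3 The age-0 layer over an older-history family: schema, representation, neutrality, flip-closure -/

section Layer

variable {ι₀ : Type*}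

/-- THE LAYERED TERM FAMILY: older histories × large-polarity patterns on the `nc K` unit-lattice cubes. [folklore] -/
def layerT (T₀ : ℕ → Finset ι₀) (nc : ℕ → ℕ) (K : ℕ) : Finset (ι₀ × Finset ℕ) := T₀ K ×ˢ (range (nc K)).powerset

/-- the number of declared factors of a layered term: one per cube. [folklore] -/
abbrev layerM (nc : ℕ → ℕ) : ℕ → ι₀ × Finset ℕ → ℕ := fun K _ => nc K

/-- the slots of a layered term: factor `i` is the age-0 slot of cube `i`. [folklore] -/
abbrev layerSlot : ℕ → ι₀ × Finset ℕ → ℕ → Σ _ : ℕ, ℕ := fun _ _ i => ⟨0, i⟩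

/-- the polarities of a layered term: read off its pattern set. [folklore] -/
abbrev layerPol : ℕ → ι₀ × Finset ℕ → ℕ → Pol := fun _ τ i => patPol τ.2 i

/-- the thresholds of a layered term: those of its older history (pattern-independent). [folklore] -/
abbrev layerThr (θ₀ : ℕ → ι₀ → ℕ → ℝ) : ℕ → ι₀ × Finset ℕ → ℕ → ℝ := fun K τ i => θ₀ K τ.1 i

/-- the window tested variables of a layered term: the cube functionals of its older history (pattern-independent). [folklore] -/
abbrev layerVar {Ωw : Type*} (v : ℕ → ι₀ → ℕ → Ωw → ℝ) : ℕ → ι₀ × Finset ℕ → ℕ → Ωw → ℝ := fun K τ i => v K τ.1 i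

/-- **THE REMAINDER OF A LAYERED TERM IS ITS OLDER HISTORY'S WEIGHT — the same for every pattern.** [folklore] -/
abbrev layerRem {Ωf : ℕ → Type*} (R : (K : ℕ) → ℝ → ι₀ → Ωf K → ℝ) : (K : ℕ) → ℝ → ι₀ × Finset ℕ → Ωf K → ℝ :=
  fun K t τ => R K t τ.1

/-- THE FLIP of slot `σ` on layered terms: toggle cube `σ.2` in the pattern set if `σ` is an age-0 slot of a cube `< nc K`, else do
nothing. [folklore] -/
def layerFlip (nc : ℕ → ℕ) (K : ℕ) (σ : Σ _ : ℕ, ℕ) (τ : ι₀ × Finset ℕ) : ι₀ × Finset ℕ :=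
  if σ.1 = 0 ∧ σ.2 < nc K then (τ.1, τ.2 ∆ {σ.2}) else τ

/-- the flip never touches the older history. [folklore] -/
@[simp] theorem layerFlip_fst (nc : ℕ → ℕ) (K : ℕ) (σ : Σ _ : ℕ, ℕ) (τ : ι₀ × Finset ℕ) : (layerFlip nc K σ τ).1 = τ.1 := by
  unfold layerFlip
  split_ifs <;> rfl

/-- membership in the layered family. [folklore] -/
theorem mem_layerT {T₀ : ℕ → Finset ι₀} {nc : ℕ → ℕ} {K : ℕ} {τ : ι₀ × Finset ℕ} :
    τ ∈ layerT T₀ nc K ↔ τ.1 ∈ T₀ K ∧ τ.2 ⊆ range (nc K) := by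
  simp [layerT, mem_product, mem_powerset]

/-- **THE LAYERED FAMILY IS FLIP-CLOSED** (§2 `FlipClosed`), for any space and any cube functionals. [folklore] -/
theorem flipClosed_layer {Ωw : ℕ → Type*} (T₀ : ℕ → Finset ι₀) (nc : ℕ → ℕ) (θ₀ : ℕ → ι₀ → ℕ → ℝ)
    (v : (K : ℕ) → ι₀ → ℕ → Ωw K → ℝ) :
    FlipClosed (Ω' := Ωw) (layerT T₀ nc) (layerM nc) layerSlot layerPol (layerThr θ₀) (fun K τ i => v K τ.1 i)
      (layerFlip nc) where
  mem K σ τ hτ := by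
    obtain ⟨h1, h2⟩ := mem_layerT.1 hτ
    refine mem_layerT.2 ⟨by simpa using h1, ?_⟩
    unfold layerFlip
    split_ifs with hσ
    · exact symmDiff_singleton_subset_range h2 hσ.2
    · exact h2
  invol K σ τ _ := by
    unfold layerFlip
    split_ifs with hσ
    · simp only [symmDiff_singleton_symmDiff_singleton, Prod.mk.eta]
    · rfl
  m_eq K σ τ _ := rfl
  slot_eq K σ τ _ j _ := rfl
  thr_eq K σ τ _ j _ := by simp [layerThr]
  var_eq K σ τ _ j _ := by simp
  pol_eq K σ τ _ j hj hne := by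
    show patPol (layerFlip nc K σ τ).2 j = patPol τ.2 j
    unfold layerFlip
    split_ifs with hσ
    · have hj2 : j ≠ σ.2 := by
        rintro rfl
        obtain ⟨a, b⟩ := σ
        simp only at hσ
        exact hne (by simp [layerSlot, hσ.1])
      exact patPol_symmDiff_ne _ hj2
    · rfl
  pol_flip K σ τ _ j hj hjσ := by
    show patPol (layerFlip nc K σ τ).2 j = polFlip (patPol τ.2 j)
    simp only [layerSlot] at hjσ
    subst hjσ
    unfold layerFlip
    rw [if_pos ⟨rfl, hj⟩]
    exact patPol_symmDiff_self _ _
  inj K τ _ j _ j' _ hjj := by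
    simp only [layerSlot, Sigma.mk.inj_iff, heq_eq_eq, true_and] at hjj
    exact hjj

variable {N : ℕ} [NeZero N] (F : T4Family)

/-- Bałaban's exp-mean-log small-plaquette average (0.4) on `SU(N)` (`ExpMeanLog.expMeanLogSU`). -/
local notation "EML" => (expMeanLogSU : LoopAverage (SU N))

/-- **THE TERM WEIGHT OF A LAYERED TERM, DEFINED** as its representing integral on run `K_X`'s finest level: the pattern's cube
factors of the window functionals along the old transport to the unit lattice, times the older history's weight, against the run's
product Haar measure. [folklore] -/
noncomputable def layerX (χ : ℕ → ℝ → ℝ) (nc : ℕ → ℕ) (θ₀ : ℕ → ι₀ → ℕ → ℝ) (v : ℕ → ι₀ → ℕ → GaugeField (F.P 0) 0 (SU N) → ℝ)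
    (KX : ℕ → ℕ) (R : (K : ℕ) → ℝ → ι₀ → GaugeField (F.P (KX K)) 0 (SU N) → ℝ) (K : ℕ) (t : ℝ) (τ : ι₀ × Finset ℕ) : ℝ :=
  ∫ U, (∏ i ∈ range (nc K), facAt χ (fun i => ⟨0, i⟩) (patPol τ.2) (θ₀ K τ.1) (fun j => v K τ.1 j (oldTr F EML (KX K) 0 U)) i) *
    R K t τ.1 U ∂fieldMeasure (F.P (KX K)) 0 (SU N)

variable {l₀ : ℝ} {T₀ : ℕ → Finset ι₀} {χ : ℕ → ℝ → ℝ} {κ Lχ : ℕ → ℝ} {N₀ : ℕ} {n nc : ℕ → ℕ} {θ₀ : ℕ → ι₀ → ℕ → ℝ}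
  {vX vY : ℕ → ι₀ → ℕ → GaugeField (F.P 0) 0 (SU N) → ℝ}

/-- **THE LAYERED FAMILY IS REPRESENTED ON RUN `K_X`'S FINEST LEVEL** in the shape of `T4FinestToWindow.cauchy_of_finest`'s binders
`hA`/`hB` with window depth `0`: profiles Lipschitz, thresholds positive, at most `n 0` cubes, cube functionals measurable on the unit
lattice, older-history weights a.e. nonnegative and integrable — the representation itself holds BY DEFINITION of `layerX`. [folklore] -/
theorem termRepr_layer (KX : ℕ → ℕ) (hχ : ∀ a, LipProfile (χ a) (κ a) (Lχ a)) (hnc : ∀ K, nc K ≤ n 0)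
    (hθ : ∀ K, ∀ τ ∈ T₀ K, ∀ i < nc K, 0 < θ₀ K τ i)
    (hv : ∀ K, ∀ τ ∈ T₀ K, ∀ i < nc K, Measurable (vX K τ i) ∧ Measurable (vY K τ i))
    {RX : (K : ℕ) → ℝ → ι₀ → GaugeField (F.P (KX K)) 0 (SU N) → ℝ}
    (hR0 : ∀ K t, |t| ≤ l₀ → ∀ τ ∈ T₀ K, 0 ≤ᵐ[fieldMeasure (F.P (KX K)) 0 (SU N)] RX K t τ)
    (hRi : ∀ K t, |t| ≤ l₀ → ∀ τ ∈ T₀ K, Integrable (RX K t τ) (fieldMeasure (F.P (KX K)) 0 (SU N))) :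
    TermRepr l₀ (layerT T₀ nc) (layerX F χ nc θ₀ vX KX RX) χ κ Lχ N₀ n (fun K _ => fieldMeasure (F.P (KX K)) 0 (SU N))
      (layerM nc) layerSlot layerPol (layerThr θ₀)
      (fun K τ i U => layerVar vX K τ i (oldTr F EML (KX K) 0 U)) (fun K τ i U => layerVar vY K τ i (oldTr F EML (KX K) 0 U))
      (layerRem RX) where
  profile := hχ
  thr_pos K τ hτ i hi := hθ K τ.1 (mem_layerT.1 hτ).1 i hi
  slot_mem K τ hτ i hi := by
    simp only [layerSlot, mem_sigma, mem_range]
    exact ⟨Nat.succ_pos _, lt_of_lt_of_le hi (hnc K)⟩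
  slot_band K τ _ i _ := Nat.zero_le K
  meas K τ hτ i hi :=
    ⟨(hv K τ.1 (mem_layerT.1 hτ).1 i hi).1.comp (measurable_oldTr_SUN F (KX K) 0),
      (hv K τ.1 (mem_layerT.1 hτ).1 i hi).2.comp (measurable_oldTr_SUN F (KX K) 0)⟩
  rem_nonneg K t ht τ hτ := hR0 K t ht τ.1 (mem_layerT.1 hτ).1
  rem_int K t ht τ hτ := hRi K t ht τ.1 (mem_layerT.1 hτ).1
  repr K t ht τ hτ := rfl

/-- **RUN A** (cutoff `K`): the binder `hA` of `cauchy_of_finest` with `NW := fun _ ↦ 0`, inhabited. [folklore] -/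
theorem termRepr_layer_A (hχ : ∀ a, LipProfile (χ a) (κ a) (Lχ a)) (hnc : ∀ K, nc K ≤ n 0)
    (hθ : ∀ K, ∀ τ ∈ T₀ K, ∀ i < nc K, 0 < θ₀ K τ i)
    (hv : ∀ K, ∀ τ ∈ T₀ K, ∀ i < nc K, Measurable (vX K τ i) ∧ Measurable (vY K τ i))
    {RA : (K : ℕ) → ℝ → ι₀ → GaugeField (F.P K) 0 (SU N) → ℝ}
    (hR0 : ∀ K t, |t| ≤ l₀ → ∀ τ ∈ T₀ K, 0 ≤ᵐ[fieldMeasure (F.P K) 0 (SU N)] RA K t τ)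
    (hRi : ∀ K t, |t| ≤ l₀ → ∀ τ ∈ T₀ K, Integrable (RA K t τ) (fieldMeasure (F.P K) 0 (SU N))) :
    TermRepr l₀ (layerT T₀ nc) (layerX F χ nc θ₀ vX (fun K => K) RA) χ κ Lχ N₀ n (fun K _ => fieldMeasure (F.P K) 0 (SU N))
      (layerM nc) layerSlot layerPol (layerThr θ₀)
      (fun K τ i U => layerVar vX K τ i (oldTr F EML K ((fun _ => 0 : ι₀ × Finset ℕ → ℕ) τ) U))
      (fun K τ i U => layerVar vY K τ i (oldTr F EML K ((fun _ => 0 : ι₀ × Finset ℕ → ℕ) τ) U)) (layerRem RA) :=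
  termRepr_layer F (fun K => K) hχ hnc hθ hv hR0 hRi

/-- **RUN B** (cutoff `K + 1`): the binder `hB` of `cauchy_of_finest` with `NW := fun _ ↦ 0`, inhabited. [folklore] -/
theorem termRepr_layer_B (hχ : ∀ a, LipProfile (χ a) (κ a) (Lχ a)) (hnc : ∀ K, nc K ≤ n 0)
    (hθ : ∀ K, ∀ τ ∈ T₀ K, ∀ i < nc K, 0 < θ₀ K τ i)
    (hv : ∀ K, ∀ τ ∈ T₀ K, ∀ i < nc K, Measurable (vX K τ i) ∧ Measurable (vY K τ i))
    {RB : (K : ℕ) → ℝ → ι₀ → GaugeField (F.P (K + 1)) 0 (SU N) → ℝ}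
    (hR0 : ∀ K t, |t| ≤ l₀ → ∀ τ ∈ T₀ K, 0 ≤ᵐ[fieldMeasure (F.P (K + 1)) 0 (SU N)] RB K t τ)
    (hRi : ∀ K t, |t| ≤ l₀ → ∀ τ ∈ T₀ K, Integrable (RB K t τ) (fieldMeasure (F.P (K + 1)) 0 (SU N))) :
    TermRepr l₀ (layerT T₀ nc) (layerX F χ nc θ₀ vX (fun K => K + 1) RB) χ κ Lχ N₀ n
      (fun K _ => fieldMeasure (F.P (K + 1)) 0 (SU N)) (layerM nc) layerSlot layerPol (layerThr θ₀)
      (fun K τ i U => layerVar vX K τ i (oldTr F EML (K + 1) ((fun _ => 0 : ι₀ × Finset ℕ → ℕ) τ) U))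
      (fun K τ i U => layerVar vY K τ i (oldTr F EML (K + 1) ((fun _ => 0 : ι₀ × Finset ℕ → ℕ) τ) U)) (layerRem RB) :=
  termRepr_layer F (fun K => K + 1) hχ hnc hθ hv hR0 hRi

/-- **NEUTRALITY OVER ONE OLDER HISTORY**: the `2^{nc K}` pattern weights over `τ'` total the older history's weight `∫ R_X K t τ' dU`
(the decomposition of unity `sum_powerset_prod_patFac` under the integral sign). [folklore] -/
theorem sum_patterns_layerX (KX : ℕ → ℕ) (hχ : ∀ a, LipProfile (χ a) (κ a) (Lχ a)) (hnc : ∀ K, nc K ≤ n 0)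
    (hθ : ∀ K, ∀ τ ∈ T₀ K, ∀ i < nc K, 0 < θ₀ K τ i)
    (hv : ∀ K, ∀ τ ∈ T₀ K, ∀ i < nc K, Measurable (vX K τ i) ∧ Measurable (vY K τ i))
    {RX : (K : ℕ) → ℝ → ι₀ → GaugeField (F.P (KX K)) 0 (SU N) → ℝ}
    (hR0 : ∀ K t, |t| ≤ l₀ → ∀ τ ∈ T₀ K, 0 ≤ᵐ[fieldMeasure (F.P (KX K)) 0 (SU N)] RX K t τ)
    (hRi : ∀ K t, |t| ≤ l₀ → ∀ τ ∈ T₀ K, Integrable (RX K t τ) (fieldMeasure (F.P (KX K)) 0 (SU N)))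
    (K : ℕ) {t : ℝ} (ht : |t| ≤ l₀) {τ' : ι₀} (hτ' : τ' ∈ T₀ K) :
    ∑ S ∈ (range (nc K)).powerset, layerX F χ nc θ₀ vX KX RX K t (τ', S) =
      ∫ U, RX K t τ' U ∂fieldMeasure (F.P (KX K)) 0 (SU N) := by
  have hrep := termRepr_layer F KX (N₀ := 0) hχ hnc hθ hv hR0 hRi
  have hI : ∀ S ∈ (range (nc K)).powerset, Integrable (fun U => (∏ i ∈ range (nc K),
      facAt χ (fun i => ⟨0, i⟩) (patPol S) (θ₀ K τ') (fun j => vX K τ' j (oldTr F EML (KX K) 0 U)) i) * RX K t τ' U)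
      (fieldMeasure (F.P (KX K)) 0 (SU N)) := fun S hS =>
    hrep.integrable_prod (K := K) (τ := (τ', S)) ht (mem_layerT.2 ⟨hτ', mem_powerset.1 hS⟩)
  unfold layerX
  rw [← integral_finsetSum _ hI]
  refine integral_congr_ae (ae_of_all _ fun U => ?_)
  show ∑ S ∈ (range (nc K)).powerset, (∏ i ∈ range (nc K),
      facAt χ (fun i => ⟨0, i⟩) (patPol S) (θ₀ K τ') (fun j => vX K τ' j (oldTr F EML (KX K) 0 U)) i) * RX K t τ' U =
    RX K t τ' U
  have h1 : ∑ S ∈ (range (nc K)).powerset, ∏ i ∈ range (nc K),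
      facAt χ (fun i => ⟨0, i⟩) (patPol S) (θ₀ K τ') (fun j => vX K τ' j (oldTr F EML (KX K) 0 U)) i = 1 :=
    sum_powerset_prod_patFac _ _
  rw [← sum_mul, h1, one_mul]

/-- **NEUTRALITY OF THE LAYER**: the layered family's total weight is the older family's total weight. [folklore] -/
theorem sum_layerT_layerX (KX : ℕ → ℕ) (hχ : ∀ a, LipProfile (χ a) (κ a) (Lχ a)) (hnc : ∀ K, nc K ≤ n 0)
    (hθ : ∀ K, ∀ τ ∈ T₀ K, ∀ i < nc K, 0 < θ₀ K τ i)
    (hv : ∀ K, ∀ τ ∈ T₀ K, ∀ i < nc K, Measurable (vX K τ i) ∧ Measurable (vY K τ i))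
    {RX : (K : ℕ) → ℝ → ι₀ → GaugeField (F.P (KX K)) 0 (SU N) → ℝ}
    (hR0 : ∀ K t, |t| ≤ l₀ → ∀ τ ∈ T₀ K, 0 ≤ᵐ[fieldMeasure (F.P (KX K)) 0 (SU N)] RX K t τ)
    (hRi : ∀ K t, |t| ≤ l₀ → ∀ τ ∈ T₀ K, Integrable (RX K t τ) (fieldMeasure (F.P (KX K)) 0 (SU N)))
    (K : ℕ) {t : ℝ} (ht : |t| ≤ l₀) {B₀ : Finset ι₀} (hB₀ : B₀ ⊆ T₀ K) :
    ∑ τ ∈ B₀ ×ˢ (range (nc K)).powerset, layerX F χ nc θ₀ vX KX RX K t τ =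
      ∑ τ' ∈ B₀, ∫ U, RX K t τ' U ∂fieldMeasure (F.P (KX K)) 0 (SU N) := by
  rw [sum_product]
  exact sum_congr rfl fun τ' hτ' => sum_patterns_layerX F KX hχ hnc hθ hv hR0 hRi K ht (hB₀ hτ')

/-- **THE BAD-CLASS BOUND TRANSFERS**: if the older family's bad class has relative weight `≤ W K` in each run, so does the layered
family's class "older history bad, any pattern" (neutrality in numerator and denominator). [folklore] -/
theorem relWeightBound_layer {A B : ℕ → ℝ → ι₀ × Finset ℕ → ℝ} {A₀ B₀ : ℕ → ℝ → ι₀ → ℝ} {Bad₀ : ℕ → ℝ → Finset ι₀}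
    {W : ℕ → ℝ} (hW : RelWeightBound l₀ T₀ A₀ B₀ Bad₀ W)
    (hA : ∀ K t, |t| ≤ l₀ → ∀ B' ⊆ T₀ K, ∑ τ ∈ B' ×ˢ (range (nc K)).powerset, A K t τ = ∑ τ' ∈ B', A₀ K t τ')
    (hB : ∀ K t, |t| ≤ l₀ → ∀ B' ⊆ T₀ K, ∑ τ ∈ B' ×ˢ (range (nc K)).powerset, B K t τ = ∑ τ' ∈ B', B₀ K t τ') :
    RelWeightBound l₀ (layerT T₀ nc) A B (fun K t => Bad₀ K t ×ˢ (range (nc K)).powerset) W where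
  bad_subset K t ht := product_subset_product_left (hW.bad_subset K t ht)
  nonneg := hW.nonneg
  lt_one := hW.lt_one
  summable := hW.summable
  bad_left K t ht := by
    show _ ≤ W K * ∑ τ ∈ T₀ K ×ˢ (range (nc K)).powerset, A K t τ
    rw [hA K t ht _ (hW.bad_subset K t ht), hA K t ht _ subset_rfl]
    exact hW.bad_left K t ht
  bad_right K t ht := by
    show _ ≤ W K * ∑ τ ∈ T₀ K ×ˢ (range (nc K)).powerset, B K t τ
    rw [hB K t ht _ (hW.bad_subset K t ht), hB K t ht _ subset_rfl]
    exact hW.bad_right K t ht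

/-- **SIBLING SUPPRESSION `S ≡ 2` FOR THE LAYER ON THE WINDOW** (the shape of `cauchy_of_finest`'s binders `hSA`/`hSB` with `NW := fun _ ↦
0`): from the window representation delivered by the socket (`termRepr_window_of_finest`) — whose remainder, the old density of the
older history's weight, is PATTERN-FREE — by §2 `siblingSuppression_two_of_flip` with the layer's flip.  No hypothesis beyond the
representation data. [folklore] -/
theorem siblingSuppression_layer (KX : ℕ → ℕ) {X : ℕ → ℝ → ι₀ × Finset ℕ → ℝ}
    {RX : (K : ℕ) → ℝ → ι₀ → GaugeField (F.P (KX K)) 0 (SU N) → ℝ} {ρ : ℕ → ℝ}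
    (hw : TermRepr l₀ (layerT T₀ nc) X χ κ Lχ N₀ n (fun _ _ => fieldMeasure (F.P 0) 0 (SU N)) (layerM nc) layerSlot layerPol
      (layerThr θ₀) (layerVar vX) (layerVar vY) (fun K t τ V => (oldDensity F EML (KX K) 0 (layerRem RX K t τ) V : ℝ))) :
    SiblingSuppression l₀ (layerT T₀ nc) X N₀ n
      (sibW χ κ (fun _ _ => fieldMeasure (F.P 0) 0 (SU N)) (layerM nc) layerSlot layerPol (layerThr θ₀) (layerVar vX)
        (fun K t τ V => (oldDensity F EML (KX K) 0 (layerRem RX K t τ) V : ℝ)) ρ) (fun _ => 2) :=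
  siblingSuppression_two_of_flip (Ω' := fun _ => GaugeField (F.P 0) 0 (SU N)) (μ := fun _ => fieldMeasure (F.P 0) 0 (SU N))
    hw (flipClosed_layer T₀ nc θ₀ fun K τ i => vX K τ i) fun K σ t _ τ _ => by
      simp only [layerRem, layerFlip_fst]
      exact Filter.EventuallyEq.rfl

end Layer

/-! ## §4 The η-design end-to-end with the age-0 layer discharged -/

section EndToEnd

variable {ι₀ : Type*} [DecidableEq ι₀] {N : ℕ} [NeZero N] (F : T4Family)

/-- Bałaban's exp-mean-log small-plaquette average (0.4) on `SU(N)` (`ExpMeanLog.expMeanLogSU`). -/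
local notation "EML" => (expMeanLogSU : LoopAverage (SU N))

/-- **`cauchy_of_finest` WITH THE AGE-0 LAYER DISCHARGED.**  Data: an older-history family `T₀` with finest-level weights `R_A K t τ'`
(run A, cutoff `K`) and `R_B K t τ'` (run B, cutoff `K + 1`), a.e. nonnegative and integrable; one Lipschitz cut-off profile `χ₀`; at
most `n₀` unit-lattice cubes with positive thresholds and measurable cube functionals `vA`, `vB` on the unit lattice.  DISCHARGED (this
module): both runs' term representations (`termRepr_layer_A/_B`), sibling suppression `S ≡ 2` in both runs (`siblingSuppression_layer`
on the socket's window representations), the window-depth and measurability side conditions, the transfer of the partition-function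
identities, of positivity and of the bad-class bound through the layer's neutrality.  REMAINING BINDERS, all at the older-history
level and all NOT PRINTED as such (nothing of Bałaban's asserted): the older family's `RelWeightBound` (cell estimate NE7b), the
two-run closeness `hvc` of the cube functionals at rate `ρ K` (node U1a), node U5b's two-sided factor ledger `hsw` between the
PATTERN-FREE old densities of the good older histories, positivity, summable `δ` and `ρ`, and `W K + n₀ · (L₀ · 2 · ρ K) < 1`.
Output: `cauchy_of_finest`'s conclusion with the budget `K ↦ W K + n₀ · (L₀ · 2 · ρ K)`. [folklore] -/
theorem cauchy_of_finest_layer {l₀ vol : ℝ} {T₀ : ℕ → Finset ι₀} {Bad₀ : ℕ → ℝ → Finset ι₀} {W δ ρ : ℕ → ℝ}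
    {χ₀ : ℝ → ℝ} {κ₀ L₀ : ℝ} (hχ : LipProfile χ₀ κ₀ L₀) {nc : ℕ → ℕ} {n₀ : ℕ} (hnc : ∀ K, nc K ≤ n₀)
    {θ₀ : ℕ → ι₀ → ℕ → ℝ} (hθ : ∀ K, ∀ τ ∈ T₀ K, ∀ i < nc K, 0 < θ₀ K τ i)
    {vA vB : ℕ → ι₀ → ℕ → GaugeField (F.P 0) 0 (SU N) → ℝ}
    (hvm : ∀ K, ∀ τ ∈ T₀ K, ∀ i < nc K, Measurable (vA K τ i) ∧ Measurable (vB K τ i))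
    (hvc : ∀ K, ∀ τ ∈ T₀ K, ∀ i < nc K,
      ∀ᵐ V ∂fieldMeasure (F.P 0) 0 (SU N), |vA K τ i V - vB K τ i V| ≤ ρ K * θ₀ K τ i)
    {RA : (K : ℕ) → ℝ → ι₀ → GaugeField (F.P K) 0 (SU N) → ℝ}
    {RB : (K : ℕ) → ℝ → ι₀ → GaugeField (F.P (K + 1)) 0 (SU N) → ℝ}
    (hRA0 : ∀ K t, |t| ≤ l₀ → ∀ τ ∈ T₀ K, 0 ≤ᵐ[fieldMeasure (F.P K) 0 (SU N)] RA K t τ)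
    (hRAi : ∀ K t, |t| ≤ l₀ → ∀ τ ∈ T₀ K, Integrable (RA K t τ) (fieldMeasure (F.P K) 0 (SU N)))
    (hRB0 : ∀ K t, |t| ≤ l₀ → ∀ τ ∈ T₀ K, 0 ≤ᵐ[fieldMeasure (F.P (K + 1)) 0 (SU N)] RB K t τ)
    (hRBi : ∀ K t, |t| ≤ l₀ → ∀ τ ∈ T₀ K, Integrable (RB K t τ) (fieldMeasure (F.P (K + 1)) 0 (SU N)))
    (hW : RelWeightBound l₀ T₀ (fun K t τ => ∫ U, RA K t τ U ∂fieldMeasure (F.P K) 0 (SU N))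
      (fun K t τ => ∫ U, RB K t τ U ∂fieldMeasure (F.P (K + 1)) 0 (SU N)) Bad₀ W)
    (hvol : 0 < vol) (hl₀ : 0 ≤ l₀) (hρ0 : ∀ j, 0 ≤ ρ j) (hρ : Summable ρ)
    (hlt : ∀ K, W K + (n₀ : ℝ) * (L₀ * 2 * ρ K) < 1) {Z : ℕ → ℝ → ℝ}
    (hZA : ∀ K t, |t| ≤ l₀ → Z K t = ∑ τ ∈ T₀ K, ∫ U, RA K t τ U ∂fieldMeasure (F.P K) 0 (SU N))
    (hZB : ∀ K t, |t| ≤ l₀ → Z (K + 1) t = ∑ τ ∈ T₀ K, ∫ U, RB K t τ U ∂fieldMeasure (F.P (K + 1)) 0 (SU N))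
    (hpos : ∀ K t, |t| ≤ l₀ → 0 < ∑ τ ∈ T₀ K, ∫ U, RA K t τ U ∂fieldMeasure (F.P K) 0 (SU N)) (hδ : Summable δ)
    {c : ℕ → ℝ}
    (hsw : ∀ K t, |t| ≤ l₀ → ∀ τ ∈ T₀ K \ Bad₀ K t,
      (∀ᵐ V ∂fieldMeasure (F.P 0) 0 (SU N),
          Real.exp (c K - vol * δ K) * (oldDensity F EML K 0 (RA K t τ) V : ℝ) ≤ (oldDensity F EML (K + 1) 0 (RB K t τ) V : ℝ)) ∧
        (∀ᵐ V ∂fieldMeasure (F.P 0) 0 (SU N),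
          (oldDensity F EML (K + 1) 0 (RB K t τ) V : ℝ) ≤ Real.exp (c K + vol * δ K) * (oldDensity F EML K 0 (RA K t τ) V : ℝ))) :
    MatchingModConstants vol l₀ (hybridDelta vol δ fun K => W K + (n₀ : ℝ) * (L₀ * 2 * ρ K)) Z ∧
      Summable (hybridDelta vol δ fun K => W K + (n₀ : ℝ) * (L₀ * 2 * ρ K)) ∧
      (∀ t : ℝ, |t| ≤ l₀ → CauchySeq fun K => genFun Z K t) ∧
      TendstoUniformlyOn (fun K t => genFun Z K t) (genFunLim Z) Filter.atTop {t | |t| ≤ l₀} := by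
  -- the profile family, the slot count by age, the suppression constants
  have hχ' : ∀ a : ℕ, LipProfile ((fun _ => χ₀) a) ((fun _ => κ₀) a) ((fun _ => L₀) a) := fun _ => hχ
  have hnc' : ∀ K, nc K ≤ (fun _ : ℕ => n₀) 0 := hnc
  -- both runs' finest-level representations (the binders `hA`, `hB`)
  have hA := termRepr_layer_A F (χ := fun _ => χ₀) (κ := fun _ => κ₀) (Lχ := fun _ => L₀) (N₀ := 0) (n := fun _ => n₀)
    hχ' hnc' hθ hvm hRA0 hRAi
  have hB := termRepr_layer_B F (χ := fun _ => χ₀) (κ := fun _ => κ₀) (Lχ := fun _ => L₀) (N₀ := 0) (n := fun _ => n₀)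
    hχ' hnc' hθ (fun K τ hτ i hi => (hvm K τ hτ i hi).symm) hRB0 hRBi
  -- the socket: both runs on the window of depth 0
  have hT : ∀ K, ∀ τ ∈ layerT T₀ nc K, (fun _ => 0 : ι₀ × Finset ℕ → ℕ) τ ≤ K := fun K _ _ => Nat.zero_le K
  have hmeas : ∀ K, ∀ τ ∈ layerT T₀ nc K, ∀ i < layerM nc K τ,
      Measurable (layerVar vA K τ i) ∧ Measurable (layerVar vB K τ i) := fun K τ hτ i hi => hvm K τ.1 (mem_layerT.1 hτ).1 i hi
  have hwA : TermRepr l₀ (layerT T₀ nc) (layerX F (fun _ => χ₀) nc θ₀ vA (fun K => K) RA) (fun _ => χ₀) (fun _ => κ₀)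
      (fun _ => L₀) 0 (fun _ => n₀) (fun _ _ => fieldMeasure (F.P 0) 0 (SU N)) (layerM nc) layerSlot layerPol (layerThr θ₀)
      (layerVar vA) (layerVar vB) (fun K t τ V => (oldDensity F EML ((fun K => K) K) 0 (layerRem RA K t τ) V : ℝ)) :=
    termRepr_window_of_finest_A F (fun _ => 0) hT hmeas hA
  have hwB : TermRepr l₀ (layerT T₀ nc) (layerX F (fun _ => χ₀) nc θ₀ vB (fun K => K + 1) RB) (fun _ => χ₀) (fun _ => κ₀)
      (fun _ => L₀) 0 (fun _ => n₀) (fun _ _ => fieldMeasure (F.P 0) 0 (SU N)) (layerM nc) layerSlot layerPol (layerThr θ₀)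
      (layerVar vB) (layerVar vA) (fun K t τ V => (oldDensity F EML ((fun K => K + 1) K) 0 (layerRem RB K t τ) V : ℝ)) :=
    termRepr_window_of_finest_B F (fun _ => 0) (fun K τ hτ => Nat.le_succ_of_le (hT K τ hτ))
      (fun K τ hτ i hi => (hmeas K τ hτ i hi).symm) hB
  -- sibling suppression `S ≡ 2` in both runs (the binders `hSA`, `hSB`)
  have hSA := siblingSuppression_layer F (fun K => K) (ρ := ρ) hwA
  have hSB := siblingSuppression_layer F (fun K => K + 1) (ρ := ρ) hwB
  -- neutrality: the partition functions and positivity transfer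
  have hsumA : ∀ K t, |t| ≤ l₀ → ∀ B' ⊆ T₀ K, ∑ τ ∈ B' ×ˢ (range (nc K)).powerset,
      layerX F (fun _ => χ₀) nc θ₀ vA (fun K => K) RA K t τ = ∑ τ' ∈ B', ∫ U, RA K t τ' U ∂fieldMeasure (F.P K) 0 (SU N) :=
    fun K t ht B' hB' => sum_layerT_layerX F (fun K => K) (χ := fun _ => χ₀) (κ := fun _ => κ₀) (Lχ := fun _ => L₀)
      (n := fun _ => n₀) hχ' hnc' hθ hvm hRA0 hRAi K ht hB'
  have hsumB : ∀ K t, |t| ≤ l₀ → ∀ B' ⊆ T₀ K, ∑ τ ∈ B' ×ˢ (range (nc K)).powerset,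
      layerX F (fun _ => χ₀) nc θ₀ vB (fun K => K + 1) RB K t τ =
        ∑ τ' ∈ B', ∫ U, RB K t τ' U ∂fieldMeasure (F.P (K + 1)) 0 (SU N) :=
    fun K t ht B' hB' => sum_layerT_layerX F (fun K => K + 1) (χ := fun _ => χ₀) (κ := fun _ => κ₀) (Lχ := fun _ => L₀)
      (n := fun _ => n₀) hχ' hnc' hθ (fun K τ hτ i hi => (hvm K τ hτ i hi).symm) hRB0 hRBi K ht hB'
  have hW' := relWeightBound_layer (nc := nc) hW hsumA hsumB
  have hZA' : ∀ K t, |t| ≤ l₀ → Z K t = ∑ τ ∈ layerT T₀ nc K, layerX F (fun _ => χ₀) nc θ₀ vA (fun K => K) RA K t τ :=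
    fun K t ht => by rw [layerT, hsumA K t ht _ subset_rfl]; exact hZA K t ht
  have hZB' : ∀ K t, |t| ≤ l₀ → Z (K + 1) t = ∑ τ ∈ layerT T₀ nc K, layerX F (fun _ => χ₀) nc θ₀ vB (fun K => K + 1) RB K t τ :=
    fun K t ht => by rw [layerT, hsumB K t ht _ subset_rfl]; exact hZB K t ht
  have hpos' : ∀ K t, |t| ≤ l₀ → 0 < ∑ τ ∈ layerT T₀ nc K, layerX F (fun _ => χ₀) nc θ₀ vA (fun K => K) RA K t τ :=
    fun K t ht => by rw [layerT, hsumA K t ht _ subset_rfl]; exact hpos K t ht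
  -- the two-run closeness of the cube functionals on the window
  have hF : SupClose (layerT T₀ nc) (fun _ _ => fieldMeasure (F.P 0) 0 (SU N)) (layerM nc) layerSlot (layerThr θ₀)
      (layerVar vA) (layerVar vB) ρ := fun K τ hτ i hi => by
    simpa [layerVar, layerSlot, layerThr] using hvc K τ.1 (mem_layerT.1 hτ).1 i hi
  -- the numerical condition with the band weight of the single age `0`
  have hlt' : ∀ K, W K + ∑ a ∈ range (0 + 1), ((fun _ : ℕ => n₀) a : ℝ) * lipWeight (fun _ => L₀) (fun _ => 2) ρ a K < 1 :=
    fun K => by simpa [lipWeight] using hlt K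
  have hS : ∀ a ≤ 0, 0 ≤ (fun _ : ℕ => (2 : ℝ)) a := fun _ _ => by norm_num
  -- node U5b's ledger on the good layered terms: pattern-free
  have hsw' : ∀ K t, |t| ≤ l₀ → ∀ τ ∈ layerT T₀ nc K \ Bad₀ K t ×ˢ (range (nc K)).powerset,
      (∀ᵐ V ∂fieldMeasure (F.P 0) 0 (SU N), Real.exp (c K - vol * δ K) *
          (oldDensity F EML K 0 (layerRem RA K t τ) V : ℝ) ≤ (oldDensity F EML (K + 1) 0 (layerRem RB K t τ) V : ℝ)) ∧
        (∀ᵐ V ∂fieldMeasure (F.P 0) 0 (SU N), (oldDensity F EML (K + 1) 0 (layerRem RB K t τ) V : ℝ) ≤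
          Real.exp (c K + vol * δ K) * (oldDensity F EML K 0 (layerRem RA K t τ) V : ℝ)) := by
    intro K t ht τ hτ
    obtain ⟨h1, h2⟩ := mem_sdiff.1 hτ
    obtain ⟨h1a, h1b⟩ := mem_layerT.1 h1
    have h3 : τ.1 ∉ Bad₀ K t := fun hb => h2 (mem_product.2 ⟨hb, mem_powerset.2 h1b⟩)
    exact hsw K t ht τ.1 (mem_sdiff.2 ⟨h1a, h3⟩)
  have main := cauchy_of_finest F (fun _ => 0) (S := fun _ => 2) hvol hl₀ hW' hT hmeas hA hB hF hSA hSB hS hρ0 hρ hlt' hZA' hZB'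
    hpos' hδ hsw'
  have e : (fun K => W K + ∑ a ∈ range (0 + 1), ((fun _ : ℕ => n₀) a : ℝ) * lipWeight (fun _ => L₀) (fun _ => 2) ρ a K) =
      fun K => W K + (n₀ : ℝ) * (L₀ * 2 * ρ K) := by
    funext K
    simp [lipWeight]
  rw [e] at main
  exact main

end EndToEnd

/-! ## §5 Sanity (kernel-checked instances; nothing printed) -/

namespace Sanity

/-- two cubes: the four patterns' factor products total one, numerically (`x₀ = 1/4`, `x₁ = 2/3`). [folklore] -/
example : ∑ S ∈ (range 2).powerset, ∏ i ∈ range 2, (patPol S i).fac ((fun i => if i = 0 then (1 / 4 : ℝ) else 2 / 3) i) = 1 :=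
  sum_powerset_prod_patFac _ _

/-- the flip at the age-0 slot of cube `1` (of `3`) toggles cube `1` and keeps the older history. [folklore] -/
example : layerFlip (ι₀ := Unit) (fun _ => 3) 7 ⟨0, 1⟩ ((), {0, 1}) = ((), {0}) := by
  decide

/-- … a slot of positive age, or of a cube outside the range, is not flipped. [folklore] -/
example : layerFlip (ι₀ := Unit) (fun _ => 3) 7 ⟨1, 1⟩ ((), {0, 1}) = ((), {0, 1}) ∧
    layerFlip (ι₀ := Unit) (fun _ => 3) 7 ⟨0, 5⟩ ((), {0, 1}) = ((), {0, 1}) := by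
  decide

/-- the sibling identity on three factors at position `1`: `p₀ p₂ = p₀ p₁ p₂ + p₀ (1 − p₁) p₂`. [folklore] -/
example (a b d : ℝ) : sibling (fun i => if i = 0 then a else if i = 1 then b else d) 3 1 =
    (∏ j ∈ range 3, (fun i => if i = 0 then a else if i = 1 then b else d) j) +
      ∏ j ∈ range 3, (fun i => if i = 0 then a else if i = 1 then 1 - b else d) j :=
  sibling_eq_prod_add_prod (by norm_num) (fun j _ hj => by simp [hj]) (by simp)

end Sanity

end Literature.MathematicalPhysics.QuantumFieldTheory.Balaban1983to89.T4AgeZeroLayer
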